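import Literature.NumberTheory.EllipticCurves.ThreeIsogenySelmerRankZeroProportionProofs
import Literature.NumberTheory.EllipticCurves.BSDWave0Proofs
import HarnessLib

/-!
# Bhargava–Klagsbrun–Lemke Oliver–Shnidman 2019, Theorem 2.5 (b) — the §9.2 argument on
# `T_{±1}(φ)` replayed in the kernel

Cross-ladder literature-typing layer (cell `bsd-littype`, seat 08, gen 8). Theorems only (no
definitions, no named facts). Source: Bhargava–Klagsbrun–Lemke Oliver–Shnidman, Duke Math. J.
**168** (2019) = arXiv:1709.09790 (REFEREED), §9.1–9.2 (held text `paper:arxiv-1709.09790`, chunk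
p0014), with the convexity inequality of Bhargava–Elkies–Shnidman, J. Lond. Math. Soc. **101**
(2020), display (8.2) (held text `paper:arxiv-1610.05759`, chunk p0017).

BKLOS §9.2 (p0014 L43–L47): "The only additional input needed is a result of Cassels which shows
that if `s ∈ T_m(φ)`, then `dim_{𝔽₃} Sel₃(E_s) ≡ m (mod 2)` […] Similarly, for twists in either
`T₁(φ)` or `T₋₁(φ)`, the `3`-Selmer rank is odd and the average `3`-Selmer rank is `4/3`. It then
immediately follows that at least `5/6` of such twists must have `3`-Selmer rank `1`." Here
`T_m(φ) = {s : c(φ_s) = 3^m}`, `m ∈ ℤ`, are the SIGNED classes of §9.1 (p0014 L33), whereas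
Theorem 2.5 (p0005 L12) uses `T_m(φ) := {s : |t(φ_s)| = m}`, `m ≥ 0` — the union of the two signed
classes `T₁ ⊔ T₋₁` for `m = 1`. The companion file `ThreeIsogenySelmerRankZeroProportionProofs`
(gen 6) replays the `T₀` half (Theorem 2.5 (a), in Selmer form); this file replays the `T_{±1}`
half — Theorem 2.5 (b): "The proportion of twists `E_s` having `3`-Selmer rank `1` is at least
`⅚ μ(T₁(φ))`" — from the same four REFEREED named facts of `IsogenySelmerGroups.lean` /
`IsogenySelmerGroupsComposite.lean`:

* `thm21_averageCard_selmerGroup` (BKLOS Thm. 2.1: average `#Sel_{φ_s}(E_s) = 1 + avg c(φ_s)`),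
* `casselsFormula_selmerRatio` (Cassels' formula, BKLOS (9.2)),
* `selmerRank_parity_of_isInSelmerRatioClass` (BES Prop. 42 (ii)),
* `lemma91_selmerGroup_exact` (BKLOS Lemma 9.1),

following §9.1–9.2: on the signed class `T₁(φ)` one has `c(φ_s) = 3`, `c(φ̂_s) = 3⁻¹`
(`c(φ)c(φ̂) = 1`), so "the average size of `Sel_{φ̂}(E'_s)` for `s ∈ T_m` is `1 + 3^{-m}`" `= 4/3`
(Thm. 2.1); off the finitely many classes carrying rational `3`-torsion (Mazur–Rubin 2010, L.5.5)
Cassels' formula reads `#Sel_φ(E_s) = 3 · #Sel_{φ̂}(E'_s)`, i.e. `r_φ = r_{φ̂} + 1`, so that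
`r₃ ≤ r_φ + r_{φ̂} = 2 r_{φ̂} + 1 ≤ 3^{r_{φ̂}} = #Sel_{φ̂}(E'_s)` (Lemma 9.1 at `ψ = [3]` and the
convexity bound BES (8.2)); hence "the average `3`-Selmer rank is [at most] `4/3`" on `T₁(φ)`, and
symmetrically (with `Sel_φ(E_s)`) on `T₋₁(φ)`; parity ("the `3`-Selmer rank is odd") and the Markov
step (`squareClassProportionGe_one_five_sixths_of_odd_of_averageLe`,
`SquareClassAverageMarkovProofs.lean`) give `≥ ⅚ μ(T_{±1})` on each signed piece, and the two
pieces add up (`SquareClassProportionGe.add_of_disjoint`).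

Hypotheses kept explicit (printed claims not typed as facts, exactly as in the `T₀` file): each
signed class `T_{±1}(φ)` is "either empty or cut out by finitely many local conditions" (p0014
L33–L34) and has a density `μ_±` ("`μ(T_m(φ))` denotes the density", p0005 L14; BKLOS §8). The
signed classes are written with the representative convention of `twistSelmerCard` /
`twistSelmerRatio` (the sign of `t(φ_s)` read at `Quotient.out t`), so that `T₁ = T₊₁ ⊔ T₋₁` holds
by definition (`hasSquareClassDensity_T1_of_signed`: `μ(T₁) = μ₊ + μ₋`).

## Main statements

* `BhargavaKlagsbrunLemkeOliverShnidman2019.squareClassProportionGe_selmerRankThree_one_of_facts`: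
  granted the four facts, for a `3`-isogeny `φ : E → E'` with dual `φ̂` over a number field
  (models with `a₁ = a₃ = 0`), if `T₊₁(φ)`, `T₋₁(φ)` are (empty or) cut out by finitely many
  local conditions, of densities `μ₊`, `μ₋`, then
  `SquareClassProportionGe (TwistClassSatisfies V (#Sel^{(3)} = 3)) (5/6 * (μ₊ + μ₋))`;
  `…_of_facts'`: the same with `μ(T₁(φ)) = μ₁` in the currency of `thm25_proportions` (b).
* `…squareClassProportionGe_rank_zero_of_facts`: Theorem 2.5 (a) in its printed RANK form
  ("rank `0`"), from the gen-6 Selmer form and `3^{rk E(K)} ≤ #Sel^{(3)}(E/K)`.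
* `…thm25_conclusions_of_facts`: both printed clauses of Theorem 2.5 for the given `φ`, modulo
  the four facts and the §9.1 framework hypotheses.

## References

* [BhargavaKlagsbrunLemkeOliverShnidman2019] Duke Math. J. 168 (2019), §9.1–9.2 (chunk p0014
  L31–L47), Thm. 2.5 (chunk p0005 L16–L22).
* [BhargavaElkiesShnidman2019] J. Lond. Math. Soc. (2) 101 (2020), Thm. 43 with display (8.2)
  (chunk p0017 L26–L37), Prop. 42 (chunk p0017 L9–L23).
* [MazurRubin2010] Invent. Math. 181 (2010), Lemma 5.5.
* [SilvermanAEC2009] VIII.§1 (Galois descent for points), X.§4 (Thm. X.4.2).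
-/

noncomputable section

open scoped Classical NumberField
open Filter Topology
open WeierstrassCurve IsDedekindDomain NumberField

universe u

namespace Literature.NumberTheory.EllipticCurves

/-! ## §1 Helpers: `c(φ) = 3^{t(φ)}`, `#E[φ](K) = 1` off rational `3`-torsion, convexity -/

section Helpers

/-- **BES (8.2) at `|m| = 1`**, real form: `2b + 1 ≤ 3^b` (from the `T₀` file's
`natLog_le_sub_one_div_two`: `b ≤ (3^b − 1)/2`). [cite: BhargavaElkiesShnidman2019, Thm. 43, display (8.2) (chunk p0017 L29–L35)] -/
theorem two_mul_add_one_le_three_pow_real (b : ℕ) : 2 * (b : ℝ) + 1 ≤ (3 : ℝ) ^ b := by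
  have h := natLog_le_sub_one_div_two (x := 3 ^ b) (r := b) rfl
  rw [Nat.log_pow (by norm_num), Nat.cast_pow, Nat.cast_ofNat] at h
  linarith

variable {K : Type u} [Field K] {W W' : WeierstrassCurve K}

/-- **`#E[φ](K) = 1` when `E(K)[n] = 0`** (`φ̂ ∘ φ = [n]`): a `Γ_K`-fixed point of `E[φ] ⊆ E(K̄)`
is `K`-rational (Galois descent, Silverman *AEC* VIII.§1, the tree's
`fixedPoints_eq_range_map_holds`) and killed by `n`, hence trivial. This is the reading of the
torsion terms `|E[φ](F)|`, `|E'[φ̂](F)|` of Cassels' formula (BKLOS (9.2)) off the finitely many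
twists with rational `3`-torsion. [cite: SilvermanAEC2009, VIII.§1 (proof of Prop. 1.2)]
[cite: BhargavaKlagsbrunLemkeOliverShnidman2019, §9.1 (chunk p0014 L35–L37, display (9.2))] -/
theorem _root_.WeierstrassCurve.Isogeny.ratKerCard_eq_one_of_natCard_torsionBy_eq_one
    [NumberField K] (φ : Isogeny W W') (ψ : Isogeny W' W) {n : ℤ}
    (hψφ : ∀ P, ψ (φ P) = n • P)
    (htors : Nat.card (AddSubgroup.torsionBy W.toAffine.Point n) = 1) : φ.ratKerCard = 1 := by
  unfold Isogeny.ratKerCard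
  rw [Nat.card_eq_one_iff_unique]
  refine ⟨⟨fun R₁ R₂ ↦ ?_⟩, ⟨⟨0, map_zero φ, fun σ ↦ smul_zero σ⟩⟩⟩
  -- every fixed point of the kernel is `O`
  suffices h0 : ∀ R : {P : W.geomPoints // φ P = 0 ∧
      ∀ σ : Field.absoluteGaloisGroup K, σ • P = P}, (R : W.geomPoints) = 0 from
    Subtype.ext ((h0 R₁).trans (h0 R₂).symm)
  intro R
  let β : W.toAffine.Point →+ W.geomPoints :=
    Affine.Point.baseChange (W' := W.toAffine) K (AlgebraicClosure K)
  have hβ : Function.Injective β := Affine.Point.map_injective _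
  -- Galois descent: `R = β Q` for a `K`-rational point `Q` (the points of `W` over `K` itself;
  -- `(W.baseChange K).toAffine.Point` and `W.toAffine.Point` agree definitionally)
  have hfix' : ∃ Q : W.toAffine.Point, β Q = (R : W.geomPoints) := by
    have hfix : (R : W.geomPoints) ∈
        MulAction.fixedPoints (Field.absoluteGaloisGroup K) W.geomPoints := R.2.2
    rw [fixedPoints_eq_range_map_holds W] at hfix
    obtain ⟨Q, hQ⟩ := hfix
    exact ⟨(show W.toAffine.Point from Q), hQ⟩
  obtain ⟨Q, hQβ⟩ := hfix'
  -- `Q` is `n`-torsion, hence `0`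
  have hnQ : n • Q = 0 := by
    apply hβ
    rw [map_zsmul, map_zero, hQβ, ← hψφ, R.2.1, map_zero]
  have hsub : Subsingleton (AddSubgroup.torsionBy W.toAffine.Point n) :=
    (Nat.card_eq_one_iff_unique.mp htors).1
  have hQmem : Q ∈ AddSubgroup.torsionBy W.toAffine.Point n :=
    (Submodule.mem_torsionBy_iff (R := ℤ) n Q).mpr hnQ
  have hQ0 : Q = 0 := by
    have := hsub.elim ⟨Q, hQmem⟩ ⟨0, zero_mem _⟩
    exact congrArg Subtype.val this
  rw [← hQβ, hQ0, map_zero]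

open BhargavaKlagsbrunLemkeOliverShnidman2019 in
/-- **`c(φ) = 3^{t(φ)}`** (granted Cassels' formula): "the global Selmer ratio `c(φ_s)` lies in
`3^ℤ`, and we take `t(φ_s) := ord₃ c(φ_s)`" (BKLOS §2, p0004 L55) — by (9.2), `c(φ)` is a quotient of
powers of `3` (the orders of `Sel_φ`, `Sel_{φ̂}`, `E[φ](F)`, `E'[φ̂](F)` are powers of `3`).
[cite: BhargavaKlagsbrunLemkeOliverShnidman2019, §2 (chunk p0004 L55) with §9.1 (chunk p0014 L35–L37)] -/
theorem selmerRatio_eq_zpow_logSelmerRatio (hC : casselsFormula_selmerRatio)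
    {K : Type} [Field K] [NumberField K] {V V' : WeierstrassCurve K} [V.IsElliptic]
    [V'.IsElliptic] (φ : Isogeny V V') (ψ : Isogeny V' V) (hφ : φ.degree = 3) (hψ : ψ.degree = 3)
    (hψφ : ∀ P, ψ (φ P) = (3 : ℤ) • P) :
    selmerRatio φ = (3 : ℚ) ^ logSelmerRatio φ := by
  haveI : Fact (Nat.Prime 3) := ⟨Nat.prime_three⟩
  obtain ⟨hf₁, hf₂, hE⟩ := hC K V V' φ ψ hφ hψφ
  obtain ⟨a, ha⟩ := φ.exists_natCard_selmerGroup_eq_pow hφ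
  obtain ⟨b, hb⟩ := ψ.exists_natCard_selmerGroup_eq_pow hψ
  obtain ⟨c, hc⟩ := φ.exists_ratKerCard_eq_pow hφ
  obtain ⟨d, hd⟩ := ψ.exists_ratKerCard_eq_pow hψ
  rw [ha, hb, hc, hd] at hE
  push_cast at hE
  have heq : selmerRatio φ = (3 : ℚ) ^ (a + d) / (3 : ℚ) ^ (b + c) := by
    rw [eq_div_iff (by positivity), pow_add, pow_add, ← hE]; ring
  have h33 : padicValRat 3 (3 : ℚ) = 1 := by
    have := padicValRat.self (p := 3) (by norm_num)
    simpa using this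
  have hval : logSelmerRatio φ = ((a + d : ℕ) : ℤ) - ((b + c : ℕ) : ℤ) := by
    unfold logSelmerRatio
    rw [heq, padicValRat.div (by positivity) (by positivity), padicValRat.pow, padicValRat.pow,
      h33]
    push_cast
    ring
  rw [heq, hval, zpow_sub₀ (by norm_num : (3 : ℚ) ≠ 0), zpow_natCast, zpow_natCast]

end Helpers

/-! ## §2 The pointwise bound on `T_{±1}(φ)`: `r₃(E) ≤ min (#Sel_φ(E), #Sel_{φ̂}(E'))` -/

section Pointwise

open BhargavaKlagsbrunLemkeOliverShnidman2019

/-- **BKLOS §9.1 / BES (8.2) at `|m| = 1`, pointwise**: for a dual pair of `3`-isogenies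
`φ : E → E'`, `φ̂` over a number field with `|t(φ)| = 1` and `E(K)[3] = E'(K)[3] = 0` (so that the
torsion terms of Cassels' formula are `1` and `#Sel_φ(E) = 3^{±1} #Sel_{φ̂}(E')`, i.e.
`|r_φ − r_{φ̂}| = 1`), the `3`-Selmer rank satisfies `r₃(E) ≤ r_φ + r_{φ̂} = 2 min(r_φ, r_{φ̂}) + 1 ≤
3^{min(r_φ, r_{φ̂})} = min(#Sel_φ(E), #Sel_{φ̂}(E'))` ("a convexity bound shows that the average rank
of `Sel_φ(E_s) ⊕ Sel_{φ̂}(E'_s)` for `s ∈ T_m` is at most `|m| + 3^{-|m|}`. Since this rank is an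
upper bound on the rank of `Sel₃(E_s)` …", p0014 L39–L41), granted Cassels' formula and Lemma 9.1.
[cite: BhargavaKlagsbrunLemkeOliverShnidman2019, §9.1 (chunk p0014 L35–L41)]
[cite: BhargavaElkiesShnidman2019, Prop. 42 (i) and display (8.2) (chunk p0017 L12, L29–L35)] -/
theorem natLog_card_selmerGroup_three_le_min_of_facts (hC : casselsFormula_selmerRatio)
    (h91 : lemma91_selmerGroup_exact) {K : Type} [Field K] [NumberField K]
    {W W' : WeierstrassCurve K} [W.IsElliptic] [W'.IsElliptic] (φ : Isogeny W W')
    (ψ : Isogeny W' W) (hφ : φ.degree = 3) (hψ : ψ.degree = 3)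
    (hψφ : ∀ P, ψ (φ P) = (3 : ℤ) • P) (hφψ : ∀ Q, φ (ψ Q) = (3 : ℤ) • Q)
    (ht : (logSelmerRatio φ).natAbs = 1)
    (hW : Nat.card (AddSubgroup.torsionBy W.toAffine.Point (3 : ℤ)) = 1)
    (hW' : Nat.card (AddSubgroup.torsionBy W'.toAffine.Point (3 : ℤ)) = 1) :
    (Nat.log 3 (Nat.card (W.selmerGroup 3)) : ℝ) ≤
      min (Nat.card φ.selmerGroup : ℝ) (Nat.card ψ.selmerGroup : ℝ) := by
  haveI : Fact (Nat.Prime 3) := ⟨Nat.prime_three⟩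
  haveI : Finite φ.selmerGroup := finite_selmerGroup_of_lemma91 h91 φ ψ (by norm_num) hψφ
  haveI : Finite ψ.selmerGroup := finite_selmerGroup_of_lemma91 h91 ψ φ (by norm_num) hφψ
  obtain ⟨a, ha⟩ := φ.exists_natCard_selmerGroup_eq_pow hφ
  obtain ⟨b, hb⟩ := ψ.exists_natCard_selmerGroup_eq_pow hψ
  obtain ⟨r, hr⟩ := exists_natCard_selmerGroup_three_eq_pow W
  -- `r ≤ a + b` (Lemma 9.1 at `ψ ∘ φ = [3]`, BES Prop 42 (i))
  have hle := natCard_selmerGroup_three_le_of_lemma91 h91 φ ψ hψφ hφψ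
  rw [hr, ha, hb, ← pow_add] at hle
  have hrab : r ≤ a + b := (Nat.pow_le_pow_iff_right (by norm_num)).mp hle
  -- Cassels with trivial torsion terms: `3^t · 3^b = 3^a`
  have hcφ : φ.ratKerCard = 1 := φ.ratKerCard_eq_one_of_natCard_torsionBy_eq_one ψ hψφ hW
  have hcψ : ψ.ratKerCard = 1 := ψ.ratKerCard_eq_one_of_natCard_torsionBy_eq_one φ hφψ hW'
  obtain ⟨-, -, hE⟩ := hC K W W' φ ψ hφ hψφ
  rw [ha, hb, hcφ, hcψ, selmerRatio_eq_zpow_logSelmerRatio hC φ ψ hφ hψ hψφ] at hE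
  push_cast at hE
  simp only [mul_one] at hE
  have h3 : (3 : ℚ) ≠ 0 := by norm_num
  have hE' : (3 : ℚ) ^ (logSelmerRatio φ + (b : ℤ)) = (3 : ℚ) ^ ((a : ℕ) : ℤ) := by
    rw [zpow_add₀ h3, zpow_natCast, zpow_natCast, hE]
  have hexp : logSelmerRatio φ + (b : ℤ) = (a : ℤ) :=
    zpow_right_injective₀ (by norm_num) (by norm_num) hE'
  -- real-number bookkeeping
  have hlog : (Nat.log 3 (3 ^ r) : ℝ) = r := by rw [Nat.log_pow (by norm_num)]
  rw [hr, hlog, ha, hb]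
  push_cast
  have h2a := two_mul_add_one_le_three_pow_real a
  have h2b := two_mul_add_one_le_three_pow_real b
  have h13 : (1 : ℝ) ≤ 3 := by norm_num
  rcases (Int.natAbs_eq_iff (n := 1)).mp ht with h1 | h1
  · -- `t(φ) = 1`: `a = b + 1`
    rw [h1] at hexp
    have hab : a = b + 1 := by omega
    have hrb : (r : ℝ) ≤ 2 * b + 1 := by exact_mod_cast (show r ≤ 2 * b + 1 by omega)
    have hpow : (3 : ℝ) ^ b ≤ (3 : ℝ) ^ a := pow_le_pow_right₀ h13 (by omega)
    exact le_min (by linarith) (by linarith)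
  · -- `t(φ) = -1`: `b = a + 1`
    rw [h1] at hexp
    have hab : b = a + 1 := by omega
    have hra : (r : ℝ) ≤ 2 * a + 1 := by exact_mod_cast (show r ≤ 2 * a + 1 by omega)
    have hpow : (3 : ℝ) ^ a ≤ (3 : ℝ) ^ b := pow_le_pow_right₀ h13 (by omega)
    exact le_min (by linarith) (by linarith)

end Pointwise

/-! ## §3 Theorem 2.5 (b): parity, the Markov step on each signed class, and their sum -/

namespace BhargavaKlagsbrunLemkeOliverShnidman2019

variable {K : Type} [Field K] [NumberField K] {V V' : WeierstrassCurve K} [V.IsElliptic]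
  [V'.IsElliptic] [V.IsCharNeTwoNF] [V'.IsCharNeTwoNF]

/-- **Parity on `T₁(φ)` off a finite set of classes** ("for twists in either `T₁(φ)` or `T₋₁(φ)`,
the `3`-Selmer rank is odd", BKLOS §9.2 p0014 L46): granted the parity fact, all but finitely many
square classes `t` have the property "if `t ∈ T₁(φ)` then every twist `E_s`, `[s] = t`, has
`#Sel^{(3)}(E_s/F) = 3^{2j+1}`" — the exceptional classes carry a non-trivial `F`-rational
`3`-torsion point (Mazur–Rubin 2010, L.5.5: the tree's `finite_setOf_twistClass_natCard_torsionBy_ne_one`).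
Companion of `eventually_even_selmerRank_on_T0`.
[cite: BhargavaKlagsbrunLemkeOliverShnidman2019, §9.2 (chunk p0014 L43–L47)] -/
theorem eventually_odd_selmerRank_on_T1 (h : selmerRank_parity_of_isInSelmerRatioClass)
    (φ : Isogeny V V') (hφ : φ.degree = 3) :
    {t : SquareClass K | ¬ (IsInSelmerRatioClass φ 1 t →
      ∀ s : Kˣ, (QuotientGroup.mk s : SquareClass K) = t →
        ∃ j : ℕ, Nat.card ((V.quadraticTwist (s : K)).selmerGroup 3) = 3 ^ (2 * j + 1))}.Finite := by
  refine (finite_setOf_twistClass_natCard_torsionBy_ne_one V (p := 3) (by decide)).subset ?_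
  intro t ht
  simp only [Set.mem_setOf_eq, Classical.not_imp, not_forall, not_exists] at ht
  obtain ⟨hT, s, hst, hs⟩ := ht
  refine ⟨s, hst, fun htors ↦ ?_⟩
  obtain ⟨r, hr, hpar⟩ := selmerRank_parity_of_torsion_trivial h φ hφ 1 s (hst ▸ hT) htors
  have hodd : Odd r := by
    rcases Nat.even_or_odd r with he | ho
    · exact absurd (hpar.1 he) (by decide)
    · exact ho
  obtain ⟨j, rfl⟩ := hodd
  exact hs j hr

/-- **The Markov–parity step of §9.2 on a sub-family of `T₁(φ)`** (abstract form): if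
`S ⊆ T₁(φ)` has density `μ`, and some real class function `g ≥ 1` with average `≤ 4/3` over `S`
bounds the `3`-Selmer rank `r₃(E_s)` (at the representative `Quotient.out`) off a finite set of
classes, then at least `⅚ μ` of all square classes lie in `S` and carry twists with
`#Sel^{(3)}(E_s/F) = 3` for every representative. (The rank is odd on `S` off the parity-exceptional
finite set; the modified function "`1` on the exceptional classes, `r₃` elsewhere" is odd, `≤ g`,
and has average `≤ 4/3`; `squareClassProportionGe_one_five_sixths_of_odd_of_averageLe`; the
exceptional classes are discarded by `SquareClassProportionGe.of_imp_off_finite`.) In §9.2, `S` is a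
signed class `T_{±1}(φ)` and `g = #Sel_{φ̂}(E'_s)` resp. `#Sel_φ(E_s)`.
[cite: BhargavaKlagsbrunLemkeOliverShnidman2019, §9.2 (chunk p0014 L46–L47, "the 3-Selmer rank is odd and the average 3-Selmer rank is 4/3 … at least 5/6")] -/
theorem squareClassProportionGe_selmerRankThree_one_of_averageLe
    (hP : selmerRank_parity_of_isInSelmerRatioClass) (φ : Isogeny V V') (hφ : φ.degree = 3)
    {S : Set (SquareClass K)} (hS1 : ∀ t ∈ S, IsInSelmerRatioClass φ 1 t)
    {μ : ℝ} (hμ : HasSquareClassDensity (fun t ↦ t ∈ S) μ)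
    {g : SquareClass K → ℝ} (hg : SquareClassAverageLe S g (4 / 3))
    (hg1 : ∀ t ∈ S, 1 ≤ g t) {F : Set (SquareClass K)} (hF : F.Finite)
    (hbound : ∀ t ∈ S, t ∉ F →
      (Nat.log 3 (Nat.card ((V.quadraticTwist ((Quotient.out t : Kˣ) : K)).selmerGroup 3)) : ℝ)
        ≤ g t) :
    SquareClassProportionGe (fun t ↦ t ∈ S ∧ TwistClassSatisfies V
      (fun E : WeierstrassCurve K ↦ Nat.card (E.selmerGroup 3) = 3) t) (5 / 6 * μ) := by
  set r₃ : SquareClass K → ℕ := fun t ↦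
    Nat.log 3 (Nat.card ((V.quadraticTwist ((Quotient.out t : Kˣ) : K)).selmerGroup 3)) with hr₃
  set F₁ : Set (SquareClass K) := {t : SquareClass K | ¬ (IsInSelmerRatioClass φ 1 t →
      ∀ s : Kˣ, (QuotientGroup.mk s : SquareClass K) = t →
        ∃ j : ℕ, Nat.card ((V.quadraticTwist (s : K)).selmerGroup 3) = 3 ^ (2 * j + 1))}
    with hF₁
  have hF₁f : F₁.Finite := eventually_odd_selmerRank_on_T1 hP φ hφ
  set G : Set (SquareClass K) := F₁ ∪ F with hG
  have hGf : G.Finite := hF₁f.union hF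
  set f : SquareClass K → ℕ := fun t ↦ if t ∈ G then 1 else r₃ t with hf
  have hpow : ∀ t : SquareClass K, ∃ r, Nat.card
      ((V.quadraticTwist ((Quotient.out t : Kˣ) : K)).selmerGroup 3) = 3 ^ r := fun t ↦ by
    haveI := V.isElliptic_quadraticTwist (Units.ne_zero (Quotient.out t : Kˣ))
    exact exists_natCard_selmerGroup_three_eq_pow _
  -- `f` is odd on `S`
  have hodd : ∀ t ∈ S, Odd (f t) := by
    intro t ht
    by_cases htG : t ∈ G
    · simp only [hf, htG, if_true]; exact odd_one
    · simp only [hf, htG, if_false, hr₃]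
      have htF₁ : t ∉ F₁ := fun h ↦ htG (Or.inl h)
      have hgood : IsInSelmerRatioClass φ 1 t →
          ∀ s : Kˣ, (QuotientGroup.mk s : SquareClass K) = t →
            ∃ j : ℕ, Nat.card ((V.quadraticTwist (s : K)).selmerGroup 3) = 3 ^ (2 * j + 1) := by
        by_contra hbad; exact htF₁ hbad
      obtain ⟨j, hj⟩ := hgood (hS1 t ht) (Quotient.out t) (QuotientGroup.out_eq' t)
      rw [hj, Nat.log_pow (by norm_num)]
      exact odd_two_mul_add_one j
  -- `f ≤ g` on `S`
  have hfle : ∀ t ∈ S, (f t : ℝ) ≤ g t := by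
    intro t ht
    by_cases htG : t ∈ G
    · simp only [hf, htG, if_true, Nat.cast_one]; exact hg1 t ht
    · simp only [hf, htG, if_false, hr₃]
      exact hbound t ht (fun h ↦ htG (Or.inr h))
  have havg : SquareClassAverageLe S (fun t ↦ (f t : ℝ)) (4 / 3) :=
    SquareClassAverageLe.mono hfle hg
  -- Markov–parity step
  have hprop : SquareClassProportionGe (fun t ↦ t ∈ S ∧ f t = 1) (5 / 6 * μ) :=
    squareClassProportionGe_one_five_sixths_of_odd_of_averageLe hμ hodd havg
  -- off `G`, `t ∈ S ∧ f t = 1` gives `#Sel₃(E_s) = 3` for every representative `s`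
  refine SquareClassProportionGe.of_imp_off_finite hGf (fun t htG ht ↦ ?_) hprop
  obtain ⟨htS, hft⟩ := ht
  refine ⟨htS, ?_⟩
  simp only [hf, htG, if_false, hr₃] at hft
  obtain ⟨r, hr⟩ := hpow t
  rw [hr, Nat.log_pow (by norm_num)] at hft
  subst hft
  rw [pow_one] at hr
  intro s hs
  exact (natCard_selmerGroup_quadraticTwist_eq_of_mk_eq V (n := 3) (by norm_num)
    (hs.trans (QuotientGroup.out_eq' t).symm)).trans hr

/-- **§9.2 on the signed class `T₊₁(φ) = {s : c(φ_s) = 3}`** (p0014 L46–L47: "for twists in …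
`T₁(φ)` …, the `3`-Selmer rank is odd and the average `3`-Selmer rank is `4/3`. It then immediately
follows that at least `5/6` of such twists must have `3`-Selmer rank `1`"), granted the four facts:
on `T₊₁(φ)` (= `T₋₁(φ̂)`), `c(φ̂_s) = 3⁻¹`, so by Thm. 2.1 the average of `#Sel_{φ̂}(E'_s)` is
`1 + 3⁻¹ = 4/3`; off the Mazur–Rubin torsion classes `r₃(E_s) ≤ #Sel_{φ̂}(E'_s)`
(`natLog_card_selmerGroup_three_le_min_of_facts`); conclude by
`squareClassProportionGe_selmerRankThree_one_of_averageLe`. The signed class is written with the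
representative convention of `twistSelmerCard` (sign of `t(φ_s)` at `s = Quotient.out t`); the
printed claims "`T₁` is either empty or cut out by finitely many local conditions" (p0014 L33–L34)
and "`μ(T₁)` denotes the density" enter as hypotheses.
[cite: BhargavaKlagsbrunLemkeOliverShnidman2019, §9.1–9.2 (chunk p0014 L33–L39, L46–L47)] -/
theorem squareClassProportionGe_selmerRankThree_one_T1pos_of_facts
    (h21 : thm21_averageCard_selmerGroup) (hC : casselsFormula_selmerRatio)
    (hP : selmerRank_parity_of_isInSelmerRatioClass) (h91 : lemma91_selmerGroup_exact)
    (φ : Isogeny V V') (ψ : Isogeny V' V) (hφ : φ.degree = 3) (hψ : ψ.degree = 3)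
    (hψφ : ∀ P, ψ (φ P) = (3 : ℤ) • P) (hφψ : ∀ Q, φ (ψ Q) = (3 : ℤ) • Q)
    (hne : {t : SquareClass K | IsInSelmerRatioClass φ 1 t ∧
      logSelmerRatio (φ.quadraticTwist (Units.ne_zero (Quotient.out t : Kˣ))) = 1}.Nonempty)
    (hloc : IsDefinedByFinitelyManyLocalConditions {t : SquareClass K | IsInSelmerRatioClass φ 1 t ∧
      logSelmerRatio (φ.quadraticTwist (Units.ne_zero (Quotient.out t : Kˣ))) = 1})
    {μ : ℝ} (hμ : HasSquareClassDensity (fun t ↦ t ∈ {t : SquareClass K |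
      IsInSelmerRatioClass φ 1 t ∧
        logSelmerRatio (φ.quadraticTwist (Units.ne_zero (Quotient.out t : Kˣ))) = 1}) μ) :
    SquareClassProportionGe (fun t ↦ t ∈ {t : SquareClass K | IsInSelmerRatioClass φ 1 t ∧
        logSelmerRatio (φ.quadraticTwist (Units.ne_zero (Quotient.out t : Kˣ))) = 1} ∧
      TwistClassSatisfies V (fun E : WeierstrassCurve K ↦ Nat.card (E.selmerGroup 3) = 3) t)
      (5 / 6 * μ) := by
  haveI : Fact (Nat.Prime 3) := ⟨Nat.prime_three⟩
  set S : Set (SquareClass K) := {t : SquareClass K | IsInSelmerRatioClass φ 1 t ∧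
      logSelmerRatio (φ.quadraticTwist (Units.ne_zero (Quotient.out t : Kˣ))) = 1} with hSdef
  -- (i) on `S`, `c(φ̂_s) = 3⁻¹` at the representative
  have hconst : ∀ t ∈ S, twistSelmerRatio ψ t = (fun _ ↦ (3 : ℝ)⁻¹) t := by
    intro t ht
    have hs := Units.ne_zero (Quotient.out t : Kˣ)
    haveI := V.isElliptic_quadraticTwist hs
    haveI := V'.isElliptic_quadraticTwist hs
    have hφ' : (φ.quadraticTwist hs).degree = 3 := by rw [Isogeny.degree_quadraticTwist, hφ]
    have hψ' : (ψ.quadraticTwist hs).degree = 3 := by rw [Isogeny.degree_quadraticTwist, hψ]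
    have hψφ' := Isogeny.quadraticTwist_comp_quadraticTwist φ ψ hψφ hs
    have hφψ' := Isogeny.quadraticTwist_comp_quadraticTwist ψ φ hφψ hs
    have hneg := logSelmerRatio_dual_eq_neg hC (φ.quadraticTwist hs) (ψ.quadraticTwist hs) hφ' hψ'
      hψφ' hφψ'
    have hval : logSelmerRatio (ψ.quadraticTwist hs) = -1 := by rw [hneg, ht.2]
    have hc := selmerRatio_eq_zpow_logSelmerRatio hC (ψ.quadraticTwist hs) (φ.quadraticTwist hs)
      hψ' hφ' hφψ'
    simp only [twistSelmerRatio, hc, hval, zpow_neg, zpow_one, Rat.cast_inv, Rat.cast_ofNat]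
  have hev := eventually_nonempty_sep_height_lt hne
  have hratio : Tendsto (squareClassAverage S (twistSelmerRatio ψ)) atTop (𝓝 (3 : ℝ)⁻¹) := by
    refine (tendsto_congr' (hev.mono fun X hX ↦ ?_)).mpr tendsto_const_nhds
    rw [show squareClassAverage S (twistSelmerRatio ψ) X =
        squareClassAverage S (fun _ ↦ (3 : ℝ)⁻¹) X from
      le_antisymm (squareClassAverage_mono (fun t ht ↦ (hconst t ht).le) X)
        (squareClassAverage_mono (fun t ht ↦ (hconst t ht).ge) X),
      squareClassAverage_const _ hX]
  -- (ii) Thm 2.1 for `φ̂` over `S`: the averages of `#Sel_{φ̂}(E'_s)` tend to `4/3`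
  have h43 : Tendsto (squareClassAverage S (twistSelmerCard ψ)) atTop (𝓝 (1 + (3 : ℝ)⁻¹)) :=
    h21 K V' V ψ hψ S hne hloc _ hratio
  have hg : SquareClassAverageLe S (twistSelmerCard ψ) (4 / 3) := by
    intro ε hε
    have e : (1 : ℝ) + 3⁻¹ = 4 / 3 := by norm_num
    rw [e] at h43
    exact ((tendsto_order.1 h43).2 (4 / 3 + ε) (by linarith)).mono fun X hX ↦ hX.le
  -- (iii) `#Sel_{φ̂}(E'_s) ≥ 1`
  have hg1 : ∀ t ∈ S, (1 : ℝ) ≤ twistSelmerCard ψ t := by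
    intro t _
    have hs := Units.ne_zero (Quotient.out t : Kˣ)
    haveI := V.isElliptic_quadraticTwist hs
    haveI := V'.isElliptic_quadraticTwist hs
    haveI : Finite (ψ.quadraticTwist hs).selmerGroup :=
      finite_selmerGroup_of_lemma91 h91 _ (φ.quadraticTwist hs) (by norm_num)
        (Isogeny.quadraticTwist_comp_quadraticTwist ψ φ hφψ hs)
    haveI : Nonempty (ψ.quadraticTwist hs).selmerGroup := ⟨0⟩
    exact Nat.one_le_cast.mpr (Nat.card_pos (α := (ψ.quadraticTwist hs).selmerGroup))
  -- (iv) pointwise bound off the torsion classes of `E` and `E'`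
  have hF := (finite_setOf_twistClass_natCard_torsionBy_ne_one V (p := 3) (by decide)).union
    (finite_setOf_twistClass_natCard_torsionBy_ne_one V' (p := 3) (by decide))
  refine squareClassProportionGe_selmerRankThree_one_of_averageLe hP φ hφ (fun t ht ↦ ht.1) hμ hg
    hg1 hF fun t ht htF ↦ ?_
  simp only [Set.mem_union, Set.mem_setOf_eq, not_or, not_exists, not_and, not_not] at htF
  have hs := Units.ne_zero (Quotient.out t : Kˣ)
  haveI := V.isElliptic_quadraticTwist hs
  haveI := V'.isElliptic_quadraticTwist hs
  have hφ' : (φ.quadraticTwist hs).degree = 3 := by rw [Isogeny.degree_quadraticTwist, hφ]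
  have hψ' : (ψ.quadraticTwist hs).degree = 3 := by rw [Isogeny.degree_quadraticTwist, hψ]
  have hmin := natLog_card_selmerGroup_three_le_min_of_facts hC h91 (φ.quadraticTwist hs)
    (ψ.quadraticTwist hs) hφ' hψ' (Isogeny.quadraticTwist_comp_quadraticTwist φ ψ hψφ hs)
    (Isogeny.quadraticTwist_comp_quadraticTwist ψ φ hφψ hs)
    (ht.1 (Quotient.out t) (QuotientGroup.out_eq' t))
    (htF.1 (Quotient.out t) (QuotientGroup.out_eq' t))
    (htF.2 (Quotient.out t) (QuotientGroup.out_eq' t))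
  exact hmin.trans (min_le_right _ _)

/-- **§9.2 on the signed class `T₋₁(φ) = {s : c(φ_s) = 3⁻¹}`** (p0014 L46–L47, "for twists in …
`T₋₁(φ)`, the `3`-Selmer rank is odd and the average `3`-Selmer rank is `4/3` … at least `5/6` of
such twists must have `3`-Selmer rank `1`"), granted the four facts: on `T₋₁(φ)`, `c(φ_s) = 3⁻¹`, so
by Thm. 2.1 the average of `#Sel_φ(E_s)` is `4/3`; off the torsion classes `r₃(E_s) ≤ #Sel_φ(E_s)`.
Hypotheses as in the `T₊₁` case.
[cite: BhargavaKlagsbrunLemkeOliverShnidman2019, §9.1–9.2 (chunk p0014 L33–L39, L46–L47)] -/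
theorem squareClassProportionGe_selmerRankThree_one_T1neg_of_facts
    (h21 : thm21_averageCard_selmerGroup) (hC : casselsFormula_selmerRatio)
    (hP : selmerRank_parity_of_isInSelmerRatioClass) (h91 : lemma91_selmerGroup_exact)
    (φ : Isogeny V V') (ψ : Isogeny V' V) (hφ : φ.degree = 3) (hψ : ψ.degree = 3)
    (hψφ : ∀ P, ψ (φ P) = (3 : ℤ) • P) (hφψ : ∀ Q, φ (ψ Q) = (3 : ℤ) • Q)
    (hne : {t : SquareClass K | IsInSelmerRatioClass φ 1 t ∧
      logSelmerRatio (φ.quadraticTwist (Units.ne_zero (Quotient.out t : Kˣ))) = -1}.Nonempty)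
    (hloc : IsDefinedByFinitelyManyLocalConditions {t : SquareClass K | IsInSelmerRatioClass φ 1 t ∧
      logSelmerRatio (φ.quadraticTwist (Units.ne_zero (Quotient.out t : Kˣ))) = -1})
    {μ : ℝ} (hμ : HasSquareClassDensity (fun t ↦ t ∈ {t : SquareClass K |
      IsInSelmerRatioClass φ 1 t ∧
        logSelmerRatio (φ.quadraticTwist (Units.ne_zero (Quotient.out t : Kˣ))) = -1}) μ) :
    SquareClassProportionGe (fun t ↦ t ∈ {t : SquareClass K | IsInSelmerRatioClass φ 1 t ∧
        logSelmerRatio (φ.quadraticTwist (Units.ne_zero (Quotient.out t : Kˣ))) = -1} ∧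
      TwistClassSatisfies V (fun E : WeierstrassCurve K ↦ Nat.card (E.selmerGroup 3) = 3) t)
      (5 / 6 * μ) := by
  haveI : Fact (Nat.Prime 3) := ⟨Nat.prime_three⟩
  set S : Set (SquareClass K) := {t : SquareClass K | IsInSelmerRatioClass φ 1 t ∧
      logSelmerRatio (φ.quadraticTwist (Units.ne_zero (Quotient.out t : Kˣ))) = -1} with hSdef
  -- (i) on `S`, `c(φ_s) = 3⁻¹` at the representative
  have hconst : ∀ t ∈ S, twistSelmerRatio φ t = (fun _ ↦ (3 : ℝ)⁻¹) t := by
    intro t ht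
    have hs := Units.ne_zero (Quotient.out t : Kˣ)
    haveI := V.isElliptic_quadraticTwist hs
    haveI := V'.isElliptic_quadraticTwist hs
    have hφ' : (φ.quadraticTwist hs).degree = 3 := by rw [Isogeny.degree_quadraticTwist, hφ]
    have hψ' : (ψ.quadraticTwist hs).degree = 3 := by rw [Isogeny.degree_quadraticTwist, hψ]
    have hc := selmerRatio_eq_zpow_logSelmerRatio hC (φ.quadraticTwist hs) (ψ.quadraticTwist hs)
      hφ' hψ' (Isogeny.quadraticTwist_comp_quadraticTwist φ ψ hψφ hs)
    simp only [twistSelmerRatio, hc, ht.2, zpow_neg, zpow_one, Rat.cast_inv, Rat.cast_ofNat]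
  have hev := eventually_nonempty_sep_height_lt hne
  have hratio : Tendsto (squareClassAverage S (twistSelmerRatio φ)) atTop (𝓝 (3 : ℝ)⁻¹) := by
    refine (tendsto_congr' (hev.mono fun X hX ↦ ?_)).mpr tendsto_const_nhds
    rw [show squareClassAverage S (twistSelmerRatio φ) X =
        squareClassAverage S (fun _ ↦ (3 : ℝ)⁻¹) X from
      le_antisymm (squareClassAverage_mono (fun t ht ↦ (hconst t ht).le) X)
        (squareClassAverage_mono (fun t ht ↦ (hconst t ht).ge) X),
      squareClassAverage_const _ hX]
  -- (ii) Thm 2.1 for `φ` over `S`: the averages of `#Sel_φ(E_s)` tend to `4/3`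
  have h43 : Tendsto (squareClassAverage S (twistSelmerCard φ)) atTop (𝓝 (1 + (3 : ℝ)⁻¹)) :=
    h21 K V V' φ hφ S hne hloc _ hratio
  have hg : SquareClassAverageLe S (twistSelmerCard φ) (4 / 3) := by
    intro ε hε
    have e : (1 : ℝ) + 3⁻¹ = 4 / 3 := by norm_num
    rw [e] at h43
    exact ((tendsto_order.1 h43).2 (4 / 3 + ε) (by linarith)).mono fun X hX ↦ hX.le
  -- (iii) `#Sel_φ(E_s) ≥ 1`
  have hg1 : ∀ t ∈ S, (1 : ℝ) ≤ twistSelmerCard φ t := by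
    intro t _
    have hs := Units.ne_zero (Quotient.out t : Kˣ)
    haveI := V.isElliptic_quadraticTwist hs
    haveI := V'.isElliptic_quadraticTwist hs
    haveI : Finite (φ.quadraticTwist hs).selmerGroup :=
      finite_selmerGroup_of_lemma91 h91 _ (ψ.quadraticTwist hs) (by norm_num)
        (Isogeny.quadraticTwist_comp_quadraticTwist φ ψ hψφ hs)
    haveI : Nonempty (φ.quadraticTwist hs).selmerGroup := ⟨0⟩
    exact Nat.one_le_cast.mpr (Nat.card_pos (α := (φ.quadraticTwist hs).selmerGroup))
  -- (iv) pointwise bound off the torsion classes of `E` and `E'`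
  have hF := (finite_setOf_twistClass_natCard_torsionBy_ne_one V (p := 3) (by decide)).union
    (finite_setOf_twistClass_natCard_torsionBy_ne_one V' (p := 3) (by decide))
  refine squareClassProportionGe_selmerRankThree_one_of_averageLe hP φ hφ (fun t ht ↦ ht.1) hμ hg
    hg1 hF fun t ht htF ↦ ?_
  simp only [Set.mem_union, Set.mem_setOf_eq, not_or, not_exists, not_and, not_not] at htF
  have hs := Units.ne_zero (Quotient.out t : Kˣ)
  haveI := V.isElliptic_quadraticTwist hs
  haveI := V'.isElliptic_quadraticTwist hs
  have hφ' : (φ.quadraticTwist hs).degree = 3 := by rw [Isogeny.degree_quadraticTwist, hφ]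
  have hψ' : (ψ.quadraticTwist hs).degree = 3 := by rw [Isogeny.degree_quadraticTwist, hψ]
  have hmin := natLog_card_selmerGroup_three_le_min_of_facts hC h91 (φ.quadraticTwist hs)
    (ψ.quadraticTwist hs) hφ' hψ' (Isogeny.quadraticTwist_comp_quadraticTwist φ ψ hψφ hs)
    (Isogeny.quadraticTwist_comp_quadraticTwist ψ φ hφψ hs)
    (ht.1 (Quotient.out t) (QuotientGroup.out_eq' t))
    (htF.1 (Quotient.out t) (QuotientGroup.out_eq' t))
    (htF.2 (Quotient.out t) (QuotientGroup.out_eq' t))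
  exact hmin.trans (min_le_left _ _)

/-- **BKLOS Theorem 2.5 (b), derived in the kernel** ("The proportion of twists `E_s` having
`3`-Selmer rank `1` is at least `⅚ μ(T₁(φ))`", p0005 L21; proof §9.2 p0014 L46–L47): granted the
four REFEREED facts (Thm. 2.1, Cassels' formula, the parity of BES Prop. 42 (ii), Lemma 9.1), for a
`3`-isogeny `φ : E → E'` with dual `φ̂` over a number field (models with `a₁ = a₃ = 0`), if the
signed classes `T₊₁(φ)`, `T₋₁(φ)` of §9.1 are each empty or cut out by finitely many local
conditions (p0014 L33–L34) and have densities `μ₊`, `μ₋`, then at least `⅚ (μ₊ + μ₋)` of all square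
classes `t` carry twists with `#Sel^{(3)}(E_s/F) = 3` (`dim_{𝔽₃} Sel₃(E_s) = 1`) for every
representative `s` of `t`. By `hasSquareClassDensity_T1_of_signed`, `μ₊ + μ₋ = μ(T₁(φ))` is the
density of Theorem 2.5's `T₁(φ) = {s : |t(φ_s)| = 1}`.
[cite: BhargavaKlagsbrunLemkeOliverShnidman2019, Thm. 2.5 (b) (chunk p0005 L20–L22) with §9.2 (chunk p0014 L46–L47)] -/
theorem squareClassProportionGe_selmerRankThree_one_of_facts
    (h21 : thm21_averageCard_selmerGroup) (hC : casselsFormula_selmerRatio)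
    (hP : selmerRank_parity_of_isInSelmerRatioClass) (h91 : lemma91_selmerGroup_exact)
    (φ : Isogeny V V') (ψ : Isogeny V' V) (hφ : φ.degree = 3) (hψ : ψ.degree = 3)
    (hψφ : ∀ P, ψ (φ P) = (3 : ℤ) • P) (hφψ : ∀ Q, φ (ψ Q) = (3 : ℤ) • Q)
    (hlocpos : {t : SquareClass K | IsInSelmerRatioClass φ 1 t ∧
        logSelmerRatio (φ.quadraticTwist (Units.ne_zero (Quotient.out t : Kˣ))) = 1}.Nonempty →
      IsDefinedByFinitelyManyLocalConditions {t : SquareClass K | IsInSelmerRatioClass φ 1 t ∧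
        logSelmerRatio (φ.quadraticTwist (Units.ne_zero (Quotient.out t : Kˣ))) = 1})
    (hlocneg : {t : SquareClass K | IsInSelmerRatioClass φ 1 t ∧
        logSelmerRatio (φ.quadraticTwist (Units.ne_zero (Quotient.out t : Kˣ))) = -1}.Nonempty →
      IsDefinedByFinitelyManyLocalConditions {t : SquareClass K | IsInSelmerRatioClass φ 1 t ∧
        logSelmerRatio (φ.quadraticTwist (Units.ne_zero (Quotient.out t : Kˣ))) = -1})
    {μpos μneg : ℝ}
    (hμpos : HasSquareClassDensity (fun t ↦ t ∈ {t : SquareClass K | IsInSelmerRatioClass φ 1 t ∧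
        logSelmerRatio (φ.quadraticTwist (Units.ne_zero (Quotient.out t : Kˣ))) = 1}) μpos)
    (hμneg : HasSquareClassDensity (fun t ↦ t ∈ {t : SquareClass K | IsInSelmerRatioClass φ 1 t ∧
        logSelmerRatio (φ.quadraticTwist (Units.ne_zero (Quotient.out t : Kˣ))) = -1}) μneg) :
    SquareClassProportionGe
      (TwistClassSatisfies V fun E : WeierstrassCurve K ↦ Nat.card (E.selmerGroup 3) = 3)
      (5 / 6 * (μpos + μneg)) := by
  set Spos : Set (SquareClass K) := {t : SquareClass K | IsInSelmerRatioClass φ 1 t ∧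
      logSelmerRatio (φ.quadraticTwist (Units.ne_zero (Quotient.out t : Kˣ))) = 1} with hSpos
  set Sneg : Set (SquareClass K) := {t : SquareClass K | IsInSelmerRatioClass φ 1 t ∧
      logSelmerRatio (φ.quadraticTwist (Units.ne_zero (Quotient.out t : Kˣ))) = -1} with hSneg
  set P : SquareClass K → Prop :=
    TwistClassSatisfies V fun E : WeierstrassCurve K ↦ Nat.card (E.selmerGroup 3) = 3 with hPdef
  have hPpos : SquareClassProportionGe (fun t ↦ t ∈ Spos ∧ P t) (5 / 6 * μpos) := by
    by_cases hne : Spos.Nonempty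
    · exact squareClassProportionGe_selmerRankThree_one_T1pos_of_facts h21 hC hP h91 φ ψ hφ hψ hψφ
        hφψ hne (hlocpos hne) hμpos
    · have hempty : ∀ t, ¬ (t ∈ Spos) := fun t ht ↦ hne ⟨t, ht⟩
      have hμ0 : μpos = 0 := hasSquareClassDensity_empty_eq_zero hempty hμpos
      exact squareClassProportionGe_of_nonpos _ (by rw [hμ0]; norm_num)
  have hPneg : SquareClassProportionGe (fun t ↦ t ∈ Sneg ∧ P t) (5 / 6 * μneg) := by
    by_cases hne : Sneg.Nonempty
    · exact squareClassProportionGe_selmerRankThree_one_T1neg_of_facts h21 hC hP h91 φ ψ hφ hψ hψφ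
        hφψ hne (hlocneg hne) hμneg
    · have hempty : ∀ t, ¬ (t ∈ Sneg) := fun t ht ↦ hne ⟨t, ht⟩
      have hμ0 : μneg = 0 := hasSquareClassDensity_empty_eq_zero hempty hμneg
      exact squareClassProportionGe_of_nonpos _ (by rw [hμ0]; norm_num)
  have hdisj : ∀ t, ¬ ((t ∈ Spos ∧ P t) ∧ (t ∈ Sneg ∧ P t)) := by
    rintro t ⟨⟨⟨-, h₁⟩, -⟩, ⟨⟨-, h₂⟩, -⟩⟩
    rw [h₁] at h₂
    norm_num at h₂
  have hsum := SquareClassProportionGe.add_of_disjoint hdisj hPpos hPneg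
  have e : 5 / 6 * μpos + 5 / 6 * μneg = 5 / 6 * (μpos + μneg) := by ring
  rw [e] at hsum
  exact SquareClassProportionGe.of_imp_off_finite Set.finite_empty
    (fun t _ ht ↦ ht.elim (fun h ↦ h.2) (fun h ↦ h.2)) hsum

omit [V.IsElliptic] [V'.IsElliptic] in
/-- **`μ(T₁(φ)) = μ(T₊₁(φ)) + μ(T₋₁(φ))`**: Theorem 2.5's `T₁(φ) = {s : |t(φ_s)| = 1}` (p0005 L12)
is the disjoint union of the signed classes `T_{±1}(φ) = {s : c(φ_s) = 3^{±1}}` of §9.1 (p0014 L33)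
(sign read at the representative `Quotient.out t`), so their densities add.
[cite: BhargavaKlagsbrunLemkeOliverShnidman2019, §2 (chunk p0005 L12–L14) with §9.1 (chunk p0014 L33)] -/
theorem hasSquareClassDensity_T1_of_signed (φ : Isogeny V V') {μpos μneg : ℝ}
    (hμpos : HasSquareClassDensity (fun t ↦ t ∈ {t : SquareClass K | IsInSelmerRatioClass φ 1 t ∧
        logSelmerRatio (φ.quadraticTwist (Units.ne_zero (Quotient.out t : Kˣ))) = 1}) μpos)
    (hμneg : HasSquareClassDensity (fun t ↦ t ∈ {t : SquareClass K | IsInSelmerRatioClass φ 1 t ∧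
        logSelmerRatio (φ.quadraticTwist (Units.ne_zero (Quotient.out t : Kˣ))) = -1}) μneg) :
    HasSquareClassDensity (IsInSelmerRatioClass φ 1) (μpos + μneg) := by
  set Spos : Set (SquareClass K) := {t : SquareClass K | IsInSelmerRatioClass φ 1 t ∧
      logSelmerRatio (φ.quadraticTwist (Units.ne_zero (Quotient.out t : Kˣ))) = 1} with hSpos
  set Sneg : Set (SquareClass K) := {t : SquareClass K | IsInSelmerRatioClass φ 1 t ∧
      logSelmerRatio (φ.quadraticTwist (Units.ne_zero (Quotient.out t : Kˣ))) = -1} with hSneg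
  have hsplit : ∀ X, squareClassProportion (IsInSelmerRatioClass φ 1) X =
      squareClassProportion (fun t ↦ t ∈ Spos) X + squareClassProportion (fun t ↦ t ∈ Sneg) X := by
    intro X
    unfold squareClassProportion
    rw [← add_div]
    congr 1
    have hfinpos : {t : SquareClass K | squareClassHeight t < X ∧ t ∈ Spos}.Finite :=
      (finite_setOf_squareClassHeight_lt X).subset fun t ht ↦ ht.1
    have hfinneg : {t : SquareClass K | squareClassHeight t < X ∧ t ∈ Sneg}.Finite :=
      (finite_setOf_squareClassHeight_lt X).subset fun t ht ↦ ht.1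
    have hunion : {t : SquareClass K | squareClassHeight t < X ∧ IsInSelmerRatioClass φ 1 t} =
        {t : SquareClass K | squareClassHeight t < X ∧ t ∈ Spos} ∪
          {t : SquareClass K | squareClassHeight t < X ∧ t ∈ Sneg} := by
      ext t
      simp only [Set.mem_setOf_eq, Set.mem_union, hSpos, hSneg]
      constructor
      · rintro ⟨hH, hT⟩
        rcases (Int.natAbs_eq_iff (n := 1)).mp (hT (Quotient.out t) (QuotientGroup.out_eq' t))
          with h | h
        · exact Or.inl ⟨hH, hT, by simpa using h⟩
        · exact Or.inr ⟨hH, hT, by simpa using h⟩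
      · rintro (⟨hH, hT, -⟩ | ⟨hH, hT, -⟩) <;> exact ⟨hH, hT⟩
    have hdisj : Disjoint {t : SquareClass K | squareClassHeight t < X ∧ t ∈ Spos}
        {t : SquareClass K | squareClassHeight t < X ∧ t ∈ Sneg} := by
      refine Set.disjoint_left.mpr fun t hpos hneg ↦ ?_
      have h₁ : logSelmerRatio (φ.quadraticTwist (Units.ne_zero (Quotient.out t : Kˣ))) = 1 :=
        hpos.2.2
      have h₂ : logSelmerRatio (φ.quadraticTwist (Units.ne_zero (Quotient.out t : Kˣ))) = -1 :=
        hneg.2.2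
      rw [h₁] at h₂
      norm_num at h₂
    rw [hunion, Nat.card_coe_set_eq, Set.ncard_union_eq hdisj hfinpos hfinneg, Nat.card_coe_set_eq,
      Nat.card_coe_set_eq, Nat.cast_add]
  unfold HasSquareClassDensity
  rw [show squareClassProportion (IsInSelmerRatioClass φ 1) =
      fun X ↦ squareClassProportion (fun t ↦ t ∈ Spos) X + squareClassProportion (fun t ↦ t ∈ Sneg) X
    from funext hsplit]
  exact hμpos.add hμneg

/-- **BKLOS Theorem 2.5 (b) in the currency of `thm25_proportions` (b)** ("`μ(T₁(φ))` denotes the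
density of `T₁(φ)`", `T₁ = {s : |t(φ_s)| = 1}`): granted the four facts and the §9.1 framework
hypotheses on the signed classes (each empty or cut out by finitely many local conditions, with
densities `μ_±`), if `T₁(φ)` has density `μ₁` then at least `⅚ μ₁` of all square classes carry
twists with `#Sel^{(3)}(E_s/F) = 3` — since `μ₁ = μ₊ + μ₋`.
[cite: BhargavaKlagsbrunLemkeOliverShnidman2019, Thm. 2.5 (b) (chunk p0005 L20–L22) with §9.2 (chunk p0014 L46–L47)] -/
theorem squareClassProportionGe_selmerRankThree_one_of_facts'
    (h21 : thm21_averageCard_selmerGroup) (hC : casselsFormula_selmerRatio)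
    (hP : selmerRank_parity_of_isInSelmerRatioClass) (h91 : lemma91_selmerGroup_exact)
    (φ : Isogeny V V') (ψ : Isogeny V' V) (hφ : φ.degree = 3) (hψ : ψ.degree = 3)
    (hψφ : ∀ P, ψ (φ P) = (3 : ℤ) • P) (hφψ : ∀ Q, φ (ψ Q) = (3 : ℤ) • Q)
    (hlocpos : {t : SquareClass K | IsInSelmerRatioClass φ 1 t ∧
        logSelmerRatio (φ.quadraticTwist (Units.ne_zero (Quotient.out t : Kˣ))) = 1}.Nonempty →
      IsDefinedByFinitelyManyLocalConditions {t : SquareClass K | IsInSelmerRatioClass φ 1 t ∧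
        logSelmerRatio (φ.quadraticTwist (Units.ne_zero (Quotient.out t : Kˣ))) = 1})
    (hlocneg : {t : SquareClass K | IsInSelmerRatioClass φ 1 t ∧
        logSelmerRatio (φ.quadraticTwist (Units.ne_zero (Quotient.out t : Kˣ))) = -1}.Nonempty →
      IsDefinedByFinitelyManyLocalConditions {t : SquareClass K | IsInSelmerRatioClass φ 1 t ∧
        logSelmerRatio (φ.quadraticTwist (Units.ne_zero (Quotient.out t : Kˣ))) = -1})
    {μpos μneg : ℝ}
    (hμpos : HasSquareClassDensity (fun t ↦ t ∈ {t : SquareClass K | IsInSelmerRatioClass φ 1 t ∧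
        logSelmerRatio (φ.quadraticTwist (Units.ne_zero (Quotient.out t : Kˣ))) = 1}) μpos)
    (hμneg : HasSquareClassDensity (fun t ↦ t ∈ {t : SquareClass K | IsInSelmerRatioClass φ 1 t ∧
        logSelmerRatio (φ.quadraticTwist (Units.ne_zero (Quotient.out t : Kˣ))) = -1}) μneg)
    {μ₁ : ℝ} (hμ₁ : HasSquareClassDensity (IsInSelmerRatioClass φ 1) μ₁) :
    SquareClassProportionGe
      (TwistClassSatisfies V fun E : WeierstrassCurve K ↦ Nat.card (E.selmerGroup 3) = 3)
      (5 / 6 * μ₁) := by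
  have e : μ₁ = μpos + μneg := tendsto_nhds_unique hμ₁ (hasSquareClassDensity_T1_of_signed φ hμpos hμneg)
  rw [e]
  exact squareClassProportionGe_selmerRankThree_one_of_facts h21 hC hP h91 φ ψ hφ hψ hψφ hφψ hlocpos
    hlocneg hμpos hμneg

/-! ## §4 Theorem 2.5 (a) in its printed RANK form, and both clauses together -/

/-- **BKLOS Theorem 2.5 (a) as printed — "The proportion of twists `E_s` having rank `0` is at least
`½ μ(T₀(φ))`"** (p0005 L18–L19), from the gen-6 Selmer form
`squareClassProportionGe_selmerGroup_trivial_of_facts'` (`Sel^{(3)}(E_s/F) = 0` for `≥ μ₀/2` of the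
classes) and the descent inequality `3^{rk E(F)} ≤ #Sel^{(3)}(E/F)` (the tree's
`WeierstrassCurve.pow_rank_le_card_selmerGroup`, Silverman *AEC* X.4.2): "this rank is an upper
bound on the rank of `Sel₃(E_s)`, which is itself an upper bound on the rank of `E_s(F)`" (p0014
L40–L41). Granted the four facts; `T₀(φ)` cut out by finitely many local conditions, of density `μ₀`.
[cite: BhargavaKlagsbrunLemkeOliverShnidman2019, Thm. 2.5 (a) (chunk p0005 L16–L19) with §9.1–9.2 (chunk p0014 L40–L46)]
[cite: SilvermanAEC2009, X.§4 (Thm. X.4.2)] -/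
theorem squareClassProportionGe_rank_zero_of_facts
    (h21 : thm21_averageCard_selmerGroup) (hC : casselsFormula_selmerRatio)
    (hP : selmerRank_parity_of_isInSelmerRatioClass) (h91 : lemma91_selmerGroup_exact)
    (φ : Isogeny V V') (ψ : Isogeny V' V) (hφ : φ.degree = 3) (hψ : ψ.degree = 3)
    (hψφ : ∀ P, ψ (φ P) = (3 : ℤ) • P) (hφψ : ∀ Q, φ (ψ Q) = (3 : ℤ) • Q)
    (hloc : IsDefinedByFinitelyManyLocalConditions {t : SquareClass K | IsInSelmerRatioClass φ 0 t})
    {μ₀ : ℝ} (hμ : HasSquareClassDensity (IsInSelmerRatioClass φ 0) μ₀) :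
    SquareClassProportionGe
      (TwistClassSatisfies V fun E : WeierstrassCurve K ↦ E.mordellWeilRank = 0) (μ₀ / 2) := by
  refine SquareClassProportionGe.of_imp_off_finite Set.finite_empty (fun t _ ht s hs ↦ ?_)
    (squareClassProportionGe_selmerGroup_trivial_of_facts' h21 hC hP h91 φ ψ hφ hψ hψφ hφψ hloc hμ)
  have h1 : Nat.card ((V.quadraticTwist (s : K)).selmerGroup 3) = 1 := ht s hs
  haveI := V.isElliptic_quadraticTwist (Units.ne_zero s)
  have hpow := (V.quadraticTwist (s : K)).pow_rank_le_card_selmerGroup (n := 3) (by norm_num)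
  simp only [Nat.cast_ofNat] at hpow
  rw [h1] at hpow
  show (V.quadraticTwist (s : K)).mordellWeilRank = 0
  by_contra hr
  have h3 : 3 ≤ 3 ^ (V.quadraticTwist (s : K)).mordellWeilRank := Nat.le_self_pow hr 3
  omega

/-- **BKLOS Theorem 2.5, both printed clauses, for the given `3`-isogeny** — literally the body of
the REFEREED binder `thm25_proportions` at `(K, E, E', φ)`: "(a) The proportion of twists `E_s`
having rank `0` is at least `½ μ(T₀(φ))`; and (b) The proportion of twists `E_s` having `3`-Selmer
rank `1` is at least `⅚ μ(T₁(φ))`" — DERIVED in the kernel from the four REFEREED facts (Thm. 2.1,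
Cassels' formula (9.2), the parity of BES Prop. 42 (ii), Lemma 9.1) modulo the printed framework
claims of §9.1 kept as hypotheses: the classes `T₀(φ)`, `T₊₁(φ)`, `T₋₁(φ)` are (empty or) "cut out by
finitely many local conditions" (p0014 L33–L34) and the signed classes `T_{±1}(φ)` have densities
(BKLOS §8; "`μ(T_m(φ))` denotes the density", p0005 L14). What is NOT derived here: those two
framework claims (the binder `thm25_proportions` itself asserts the conclusions from the densities of
`T₀`, `T₁` alone).
[cite: BhargavaKlagsbrunLemkeOliverShnidman2019, Thm. 2.5 (chunk p0005 L16–L22) with §9.1–9.2 (chunk p0014 L31–L47)] -/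
theorem thm25_conclusions_of_facts
    (h21 : thm21_averageCard_selmerGroup) (hC : casselsFormula_selmerRatio)
    (hP : selmerRank_parity_of_isInSelmerRatioClass) (h91 : lemma91_selmerGroup_exact)
    (φ : Isogeny V V') (ψ : Isogeny V' V) (hφ : φ.degree = 3) (hψ : ψ.degree = 3)
    (hψφ : ∀ P, ψ (φ P) = (3 : ℤ) • P) (hφψ : ∀ Q, φ (ψ Q) = (3 : ℤ) • Q)
    (hloc₀ : IsDefinedByFinitelyManyLocalConditions {t : SquareClass K | IsInSelmerRatioClass φ 0 t})
    (hlocpos : {t : SquareClass K | IsInSelmerRatioClass φ 1 t ∧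
        logSelmerRatio (φ.quadraticTwist (Units.ne_zero (Quotient.out t : Kˣ))) = 1}.Nonempty →
      IsDefinedByFinitelyManyLocalConditions {t : SquareClass K | IsInSelmerRatioClass φ 1 t ∧
        logSelmerRatio (φ.quadraticTwist (Units.ne_zero (Quotient.out t : Kˣ))) = 1})
    (hlocneg : {t : SquareClass K | IsInSelmerRatioClass φ 1 t ∧
        logSelmerRatio (φ.quadraticTwist (Units.ne_zero (Quotient.out t : Kˣ))) = -1}.Nonempty →
      IsDefinedByFinitelyManyLocalConditions {t : SquareClass K | IsInSelmerRatioClass φ 1 t ∧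
        logSelmerRatio (φ.quadraticTwist (Units.ne_zero (Quotient.out t : Kˣ))) = -1})
    {μpos μneg : ℝ}
    (hμpos : HasSquareClassDensity (fun t ↦ t ∈ {t : SquareClass K | IsInSelmerRatioClass φ 1 t ∧
        logSelmerRatio (φ.quadraticTwist (Units.ne_zero (Quotient.out t : Kˣ))) = 1}) μpos)
    (hμneg : HasSquareClassDensity (fun t ↦ t ∈ {t : SquareClass K | IsInSelmerRatioClass φ 1 t ∧
        logSelmerRatio (φ.quadraticTwist (Units.ne_zero (Quotient.out t : Kˣ))) = -1}) μneg) :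
    (∀ μ₀ : ℝ, HasSquareClassDensity (IsInSelmerRatioClass φ 0) μ₀ →
        SquareClassProportionGe
          (TwistClassSatisfies V fun E : WeierstrassCurve K ↦ E.mordellWeilRank = 0) (μ₀ / 2)) ∧
    (∀ μ₁ : ℝ, HasSquareClassDensity (IsInSelmerRatioClass φ 1) μ₁ →
        SquareClassProportionGe
          (TwistClassSatisfies V fun E : WeierstrassCurve K ↦ Nat.card (E.selmerGroup 3) = 3)
          (5 / 6 * μ₁)) :=
  ⟨fun _ hμ₀ ↦ squareClassProportionGe_rank_zero_of_facts h21 hC hP h91 φ ψ hφ hψ hψφ hφψ hloc₀ hμ₀,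
    fun _ hμ₁ ↦ squareClassProportionGe_selmerRankThree_one_of_facts' h21 hC hP h91 φ ψ hφ hψ hψφ
      hφψ hlocpos hlocneg hμpos hμneg hμ₁⟩

end BhargavaKlagsbrunLemkeOliverShnidman2019

end Literature.NumberTheory.EllipticCurves
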